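import Literature.RepresentationTheory.HeisenbergGroup.SchrodingerLeraySectionUnramified
import Literature.RepresentationTheory.HeisenbergGroup.SchrodingerLeraySectionSmooth
import Literature.RepresentationTheory.HeisenbergGroup.SchrodingerPiGeneration
import HarnessLib

/-!
# A Leray-normalised section fixes `1_{𝒪^ι}` on the integral points of the stabiliser of its Lagrangian

Topic `RepresentationTheory/HeisenbergGroup`; namespace `Literature.RepresentationTheory.HeisenbergGroup`. KERNEL
mathematics only (theorems; no definition, no named fact, no `axiom`, no `sorry`). Sequel of
`SchrodingerLeraySectionUnramified.lean` (the Schrödinger–Leray section fixes `1_{𝒪^ι}` on the integral generators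
`m(a)`, `n(c)`), `SchrodingerLeraySectionSmooth.lean` (`q ∈ P_{ℓ_Y} ⇒ q = m(a) n(c)`; rigidity of Leray sections)
and `SchrodingerUnramifiedVector.lean` (every implementer of an integral symplectic element maps `1_{𝒪^ι}` into
`ℂˣ 1_{𝒪^ι}`).

THE UNRAMIFIED PARABOLIC CLAUSE. `F` a non-archimedean local field of characteristic `0`, `ψ` of conductor `𝒪 = 𝔭⁰`,
`2 ∈ 𝒪^×`, `T ∈ GL_ι(𝒪)` a Gram duality `β_T(x, y) = ⟨x, T y⟩` on `W = F^ι × F^ι` with symplectic form `A_T`, `Λ = 𝒪^ι × 𝒪^ι`,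
`ℓ` a Lagrangian of `A_T` of the form `ℓ = δ ℓ_Y` (`ℓ_Y = 0 × F^ι`) for some INTEGRAL `δ ∈ Sp(W, A_T)` (`δ Λ ⊆ Λ`), and `r` a
normalised section of implementers of `ρ_T = schrodingerSB β_T ψ` on `𝒮(F^ι)` whose cocycle is the Leray cocycle
`c^{ψ(½·)}_ℓ` (the shape produced by `SchrodingerLeraySectionGram.exists_implementerSection_cocycle_eq_lerayCentralCocycle_gram`).
THEN `r(g) 1_{𝒪^ι} = 1_{𝒪^ι}` for every `g ∈ Sp(W, A_T)` with `g ℓ = ℓ` and `g Λ ⊆ Λ`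
(`apply_integersIndicator_eq_self_of_parabolic_of_mapsTo`; matrix form `…_of_parabolic_transportSp`).
Proof ([MoeglinVignerasWaldspurger1987] Chap. 2 II.8–II.10; [Rangarao1993] Thm 3.5, Lemma 5.1): by rigidity
(`leraySection_apply_conj`, `Sp(W, A_T)` has no characters) `r(δ q δ⁻¹) = r_Y(δ) r_Y(q) r_Y(δ)⁻¹` with `r_Y` the transport
to `ρ_T` of the Schrödinger–Leray section and `q = δ⁻¹ g δ ∈ P_{ℓ_Y}(𝒪)`; `r_Y(δ) 1_𝒪 = c 1_𝒪`, `c ∈ ℂˣ`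
(`SchrodingerUnramifiedVector`), and `r_Y(q) 1_𝒪 = leviOpPi a (unipOpPi c' 1_𝒪) = 1_𝒪` for `q = m(a) n(c')` with
`a, a⁻¹, c'` integral (`SchrodingerLeraySectionUnramified`).  Also: every `g ∈ Sp(W, A_T)` with `g Λ ⊆ Λ` is
`transportSp T (A)`, `A ∈ Sp_{2ι}(𝒪_F)` (`exists_eq_transportSp_mapHom_of_mapsTo`), whence
`ImplementerSection.exists_apply_integersIndicator_eq_smul_of_mapsTo` (`r(g) 1_𝒪 ∈ ℂˣ 1_𝒪` for integral `g`).
This is the parabolic part of the unramified clause `ω_v(K_v) 1_{𝒪_v^N} = 1_{𝒪_v^N}` of [GelbartRogawski1991] §3.1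
(3.1.3), p. 456, written for GR-1's stub `L7` of the local splitting skeleton of [GelbartRogawski1991, Prop. 3.1.1]
(stage-1 cell `pub-hodgecm`). Nothing here is a claim of the manuscripts adjudicated there.

## References

* C. Mœglin, M.-F. Vignéras, J.-L. Waldspurger, LNM 1291 (1987), Chap. 2 II.1, II.8–II.10; Chap. 3 §I.3
  [MoeglinVignerasWaldspurger1987].
* R. Ranga Rao, Pacific J. Math. 157 (1993) 335–371: §2.2, Thm 3.5, Thm 4.1, Lemma 5.1 [Rangarao1993].
* S. Gelbart, J. Rogawski, Invent. Math. 105 (1991), §3.1 (3.1.3), p. 456 [GelbartRogawski1991].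
* A. Weil, Acta Math. 111 (1964) 143–211: n° 5–6, n° 19–20, n° 34 [Weil1964].
* A. Weil, *Basic Number Theory* (1967), Ch. II §2 [WeilBNT1967].
-/

set_option autoImplicit false

noncomputable section

namespace Literature.RepresentationTheory.HeisenbergGroup

open _root_.MeasureTheory Matrix ValuativeRel
open Literature.GroupTheory Literature.NumberTheory.Automorphic
open Literature.NumberTheory.GaloisRepresentations.IsNonarchimedeanLocalField
open Literature.NumberTheory.Weil1964 Literature.LinearAlgebra.QuadraticForm
open SymplecticMatrix

/-! ## §1 The lattice `Λ = 𝒪^ι × 𝒪^ι` -/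

section Lattice

variable {F : Type*} [Field F] [ValuativeRel F] [TopologicalSpace F] [IsNonarchimedeanLocalField F]
  {ι : Type*} [Fintype ι] [DecidableEq ι]

omit [Fintype ι] [DecidableEq ι] in
/-- `1 ∈ 𝒪 = 𝔭⁰`. [cite: WeilBNT1967, Ch. II §2] -/
private theorem one_mem_integers : (1 : F) ∈ primePowBall F 0 := by
  rw [mem_primePowBall_iff, map_one, zpow_zero]

/-- **the matrix entries of a linear map preserving `𝒪^ι` are integral** (`[a]_{ij} = (a e_j)_i`).
[cite: WeilBNT1967, Ch. II §2, Prop. 4] -/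
theorem toMatrix'_mem_integers_of_mapsTo (a : (ι → F) →ₗ[F] (ι → F))
    (ha : ∀ u ∈ piPrimePowBall F ι 0, a u ∈ piPrimePowBall F ι 0) (i j : ι) :
    LinearMap.toMatrix' a i j ∈ primePowBall F 0 := by
  rw [LinearMap.toMatrix'_apply]
  exact mem_piPrimePowBall_iff.1 (ha _ (single_mem_piPrimePowBall j one_mem_integers)) i

omit [Fintype ι] [DecidableEq ι] in
/-- `Sum.elim` of two integral vectors is an integral vector on `ι ⊕ ι`. [cite: WeilBNT1967, Ch. II §2] -/
private theorem sumElim_mem {a b : ι → F} (ha : a ∈ piPrimePowBall F ι 0) (hb : b ∈ piPrimePowBall F ι 0) :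
    Sum.elim a b ∈ piPrimePowBall F (ι ⊕ ι) 0 :=
  mem_piPrimePowBall_iff.2 fun k => by
    cases k with
    | inl i => exact mem_piPrimePowBall_iff.1 ha i
    | inr i => exact mem_piPrimePowBall_iff.1 hb i

omit [Fintype ι] [DecidableEq ι] in
/-- the `inl`-half of an integral vector on `ι ⊕ ι` is integral. [cite: WeilBNT1967, Ch. II §2] -/
private theorem comp_inl_mem {u : ι ⊕ ι → F} (hu : u ∈ piPrimePowBall F (ι ⊕ ι) 0) :
    u ∘ Sum.inl ∈ piPrimePowBall F ι 0 :=
  mem_piPrimePowBall_iff.2 fun i => mem_piPrimePowBall_iff.1 hu (Sum.inl i)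

omit [Fintype ι] [DecidableEq ι] in
/-- the `inr`-half of an integral vector on `ι ⊕ ι` is integral. [cite: WeilBNT1967, Ch. II §2] -/
private theorem comp_inr_mem {u : ι ⊕ ι → F} (hu : u ∈ piPrimePowBall F (ι ⊕ ι) 0) :
    u ∘ Sum.inr ∈ piPrimePowBall F ι 0 :=
  mem_piPrimePowBall_iff.2 fun i => mem_piPrimePowBall_iff.1 hu (Sum.inr i)

variable (T : Matrix ι ι F) (hT : IsUnit T.det)

/-- `e_T (x, y) = (x, T y)` preserves `Λ = 𝒪^ι × 𝒪^ι` for `T` integral. [cite: WeilBNT1967, Ch. II §2, Prop. 4] -/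
theorem gramProd_apply_mem (hTi : ∀ i j, T i j ∈ primePowBall F 0) {v : (ι → F) × (ι → F)}
    (hv : v ∈ (piPrimePowBall F ι 0) ×ˢ (piPrimePowBall F ι 0)) :
    gramProd T hT v ∈ (piPrimePowBall F ι 0) ×ˢ (piPrimePowBall F ι 0) := by
  rw [gramProd_apply]
  exact Set.mk_mem_prod (Set.mem_prod.1 hv).1 (mulVec_mem_piPrimePowBall_zero hTi (Set.mem_prod.1 hv).2)

/-- `e_T⁻¹ (x, y) = (x, T⁻¹ y)` preserves `Λ` for `T⁻¹` integral. [cite: WeilBNT1967, Ch. II §2, Prop. 4] -/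
theorem gramProd_symm_apply_mem (hTi' : ∀ i j, T⁻¹ i j ∈ primePowBall F 0) {v : (ι → F) × (ι → F)}
    (hv : v ∈ (piPrimePowBall F ι 0) ×ˢ (piPrimePowBall F ι 0)) :
    (gramProd T hT).symm v ∈ (piPrimePowBall F ι 0) ×ˢ (piPrimePowBall F ι 0) := by
  rw [gramProd_symm_apply T hT]
  exact Set.mk_mem_prod (Set.mem_prod.1 hv).1 (mulVec_mem_piPrimePowBall_zero hTi' (Set.mem_prod.1 hv).2)

/-- **`transportSp T (f A)`, `A ∈ Sp_{2ι}(R)`, `f(R) ⊆ 𝒪`, preserves `Λ = 𝒪^ι × 𝒪^ι`** when `T, T⁻¹ ∈ M_ι(𝒪)`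
(`P⁻¹ A P` with `P (x, y) = (x, T y)`). [cite: MoeglinVignerasWaldspurger1987, Chap. 2 II.10; WeilBNT1967, Ch. II §2, Prop. 4] -/
theorem transportSp_mapHom_apply_mem (hTi : ∀ i j, T i j ∈ primePowBall F 0)
    (hTi' : ∀ i j, T⁻¹ i j ∈ primePowBall F 0) {R : Type*} [CommRing R] (f : R →+* F)
    (hf : ∀ x : R, f x ∈ primePowBall F 0) (A : Matrix.symplecticGroup ι R) {v : (ι → F) × (ι → F)}
    (hv : v ∈ (piPrimePowBall F ι 0) ×ˢ (piPrimePowBall F ι 0)) :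
    ((transportSp T hT (mapHom f A) : symplecticGroup (polar (Matrix.toLinearMap₂' F T))) :
        ((ι → F) × (ι → F)) ≃ₗ[F] ((ι → F) × (ι → F))) v ∈ (piPrimePowBall F ι 0) ×ˢ (piPrimePowBall F ι 0) := by
  rw [coe_transportSp_apply, coe_mapHom, darboux_apply, darboux_symm_apply]
  have hu : ((A : Matrix (ι ⊕ ι) (ι ⊕ ι) R).map f) *ᵥ Sum.elim v.1 (T *ᵥ v.2) ∈ piPrimePowBall F (ι ⊕ ι) 0 :=
    mulVec_mem_piPrimePowBall_zero (fun i j => by rw [Matrix.map_apply]; exact hf _)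
      (sumElim_mem (Set.mem_prod.1 hv).1 (mulVec_mem_piPrimePowBall_zero hTi (Set.mem_prod.1 hv).2))
  exact Set.mk_mem_prod (comp_inl_mem hu) (mulVec_mem_piPrimePowBall_zero hTi' (comp_inr_mem hu))

/-- **every `g ∈ Sp(W, A_T)` preserving `Λ = 𝒪^ι × 𝒪^ι` is `transportSp T (A)` for some `A ∈ Sp_{2ι}(𝒪_F)`**
(`T, T⁻¹ ∈ M_ι(𝒪)`): its Darboux matrix `P g P⁻¹` is integral and symplectic.
[cite: MoeglinVignerasWaldspurger1987, Chap. 2 II.10; Weil1964, n° 5, p. 150] -/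
theorem exists_eq_transportSp_mapHom_of_mapsTo (hTi : ∀ i j, T i j ∈ primePowBall F 0)
    (hTi' : ∀ i j, T⁻¹ i j ∈ primePowBall F 0) (g : symplecticGroup (polar (Matrix.toLinearMap₂' F T)))
    (hgi : ∀ v ∈ (piPrimePowBall F ι 0) ×ˢ (piPrimePowBall F ι 0),
      (g : ((ι → F) × (ι → F)) ≃ₗ[F] ((ι → F) × (ι → F))) v ∈ (piPrimePowBall F ι 0) ×ˢ (piPrimePowBall F ι 0)) :
    ∃ A : Matrix.symplecticGroup ι 𝒪[F], transportSp T hT (mapHom (Valuation.integer (valuation F)).subtype A) = g := by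
  -- the Darboux matrix of `g` is integral
  have hint : ∀ i j, darbouxMatrix T hT (g : ((ι → F) × (ι → F)) ≃ₗ[F] ((ι → F) × (ι → F))) i j ∈ 𝒪[F] := by
    intro i j
    have hs : (Pi.single j (1 : F) : ι ⊕ ι → F) ∈ piPrimePowBall F (ι ⊕ ι) 0 :=
      single_mem_piPrimePowBall j one_mem_integers
    have hu : (darboux T hT).symm (Pi.single j (1 : F)) ∈ (piPrimePowBall F ι 0) ×ˢ (piPrimePowBall F ι 0) := by
      rw [darboux_symm_apply]
      exact Set.mk_mem_prod (comp_inl_mem hs) (mulVec_mem_piPrimePowBall_zero hTi' (comp_inr_mem hs))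
    have hw := hgi _ hu
    have hd : darboux T hT ((g : ((ι → F) × (ι → F)) ≃ₗ[F] ((ι → F) × (ι → F))) ((darboux T hT).symm (Pi.single j 1)))
        ∈ piPrimePowBall F (ι ⊕ ι) 0 := by
      rw [darboux_apply]
      exact sumElim_mem (Set.mem_prod.1 hw).1 (mulVec_mem_piPrimePowBall_zero hTi (Set.mem_prod.1 hw).2)
    have h : darbouxMatrix T hT (g : ((ι → F) × (ι → F)) ≃ₗ[F] ((ι → F) × (ι → F))) i j =
        darboux T hT ((g : ((ι → F) × (ι → F)) ≃ₗ[F] ((ι → F) × (ι → F))) ((darboux T hT).symm (Pi.single j 1))) i := by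
      rw [darbouxMatrix, LinearMap.toMatrix'_apply]; rfl
    rw [h]
    have hi := mem_piPrimePowBall_iff.1 hd i
    rw [mem_primePowBall_iff, zpow_zero] at hi
    exact normAbs_le_one_iff.1 hi
  set A : Matrix (ι ⊕ ι) (ι ⊕ ι) 𝒪[F] :=
    Matrix.of fun i j => ⟨darbouxMatrix T hT (g : ((ι → F) × (ι → F)) ≃ₗ[F] ((ι → F) × (ι → F))) i j, hint i j⟩ with hA_def
  have hAf : A.map (Valuation.integer (valuation F)).subtype =
      darbouxMatrix T hT (g : ((ι → F) × (ι → F)) ≃ₗ[F] ((ι → F) × (ι → F))) := by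
    ext i j; rfl
  have hA : A ∈ Matrix.symplecticGroup ι 𝒪[F] := by
    have hF := darbouxMatrix_mem_symplecticGroup T hT g
    rw [SymplecticGroup.mem_iff] at hF ⊢
    apply Matrix.map_injective (f := ⇑(Valuation.integer (valuation F)).subtype) Subtype.val_injective
    change (A * J ι 𝒪[F] * Aᵀ).map (Valuation.integer (valuation F)).subtype =
      (J ι 𝒪[F]).map (Valuation.integer (valuation F)).subtype
    rw [Matrix.map_mul, Matrix.map_mul, Matrix.transpose_map, Matrix.map_J, hAf]
    exact hF
  refine ⟨⟨A, hA⟩, Subtype.ext (LinearEquiv.ext fun v => ?_)⟩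
  rw [coe_transportSp_apply, coe_mapHom]
  change (darboux T hT).symm (A.map (Valuation.integer (valuation F)).subtype *ᵥ darboux T hT v) = _
  rw [hAf, darbouxMatrix_mulVec, LinearEquiv.symm_apply_apply, LinearEquiv.symm_apply_apply]

omit [Fintype ι] [DecidableEq ι] in
/-- the inclusion `𝒪_F ⊆ F` takes values in `𝒪 = 𝔭⁰` (for `SchrodingerUnramifiedVector`'s hypothesis `hf`).
[cite: WeilBNT1967, Ch. II §2] -/
theorem integer_subtype_mem (x : 𝒪[F]) : (Valuation.integer (valuation F)).subtype x ∈ primePowBall F 0 := by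
  rw [mem_primePowBall_iff, zpow_zero]
  exact normAbs_le_one_iff.2 x.2

end Lattice

/-! ## §1b The inverse of a conjugate `e g e⁻¹` -/

section ConjSymm

variable {R : Type*} [CommRing R] {V : Type*} [AddCommGroup V] [Module R V]
  {V' : Type*} [AddCommGroup V'] [Module R V']
  {B : V →ₗ[R] V →ₗ[R] R} {B' : V' →ₗ[R] V' →ₗ[R] R}
  (e : V ≃ₗ[R] V') (hB : ∀ v w : V, B' (e v) (e w) = B v w)

/-- `(e g e⁻¹)⁻¹ v' = e (g⁻¹ (e⁻¹ v'))`. [cite: Weil1964, n° 5, p. 150] -/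
private theorem symplecticConj_coe_symm_apply (g : symplecticGroup B) (v' : V') :
    ((symplecticConj e hB g : symplecticGroup B') : V' ≃ₗ[R] V').symm v' = e ((g : V ≃ₗ[R] V).symm (e.symm v')) :=
  rfl

/-- `e g e⁻¹` stabilises `L' = e L` when `g` stabilises `L`. [cite: Weil1964, n° 5, p. 150] -/
private theorem map_symplecticConj_eq (g : symplecticGroup B) {L : Submodule R V} {L' : Submodule R V'}
    (h₁ : L'.map (e.symm : V' →ₗ[R] V) = L) (h₂ : L.map ((g : V ≃ₗ[R] V) : V →ₗ[R] V) = L)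
    (h₃ : L.map (e : V →ₗ[R] V') = L') :
    L'.map (((symplecticConj e hB g : symplecticGroup B') : V' ≃ₗ[R] V') : V' →ₗ[R] V') = L' := by
  rw [coe_symplecticConj, LinearEquiv.coe_trans, LinearEquiv.coe_trans, Submodule.map_comp, Submodule.map_comp, h₁,
    h₂, h₃]

/-- `e g e⁻¹` preserves `S'` when `e : S → S'`, `e⁻¹ : S' → S` and `g` preserves `S`. [cite: Weil1964, n° 5, p. 150] -/
private theorem symplecticConj_apply_mem (g : symplecticGroup B) {S : Set V} {S' : Set V'}
    (he : ∀ v ∈ S, e v ∈ S') (he' : ∀ v' ∈ S', e.symm v' ∈ S) (hg : ∀ v ∈ S, (g : V ≃ₗ[R] V) v ∈ S)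
    {v' : V'} (hv' : v' ∈ S') : ((symplecticConj e hB g : symplecticGroup B') : V' ≃ₗ[R] V') v' ∈ S' :=
  he _ (hg _ (he' _ hv'))

/-- … and so does its inverse when `g⁻¹` preserves `S`. [cite: Weil1964, n° 5, p. 150] -/
private theorem symplecticConj_symm_apply_mem (g : symplecticGroup B) {S : Set V} {S' : Set V'}
    (he : ∀ v ∈ S, e v ∈ S') (he' : ∀ v' ∈ S', e.symm v' ∈ S) (hg' : ∀ v ∈ S, (g : V ≃ₗ[R] V).symm v ∈ S)
    {v' : V'} (hv' : v' ∈ S') : ((symplecticConj e hB g : symplecticGroup B') : V' ≃ₗ[R] V').symm v' ∈ S' :=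
  he _ (hg' _ (he' _ hv'))

end ConjSymm

/-! ## §2 The Schrödinger–Leray section on `P_{ℓ_Y}(𝒪)` -/

section PiY

variable {F : Type*} [Field F] [ValuativeRel F] [TopologicalSpace F] [IsNonarchimedeanLocalField F]
  {ι : Type*} [Fintype ι] [DecidableEq ι] [Invertible (2 : F)]
  {ψ : AddChar F Circle} (hl : IsLocallyConstant (⇑ψ : F → Circle))
  [MeasurableSpace F] [BorelSpace F] (μ : Measure F) [μ.IsAddHaarMeasure]
  (Φ₀ : SchwartzBruhat (ι → F)) (hΦ₀ : (Φ₀ : (ι → F) → ℂ) = (piPrimePowBall F ι 0).indicator fun _ => (1 : ℂ))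

include hΦ₀ in
/-- **`r_Y(q) 1_{𝒪^ι} = 1_{𝒪^ι}` for `q ∈ P_{ℓ_Y}(𝒪)`**: an element of the Siegel parabolic with `q Λ ⊆ Λ ⊇ q⁻¹ Λ`
(`Λ = 𝒪^ι × 𝒪^ι`) is `m(a) n(c)` with `a = A(q)`, `a⁻¹ = A(q⁻¹)`, `c = ᵗa C(q)` integral, and both normalised
operators fix `1_{𝒪^ι}` (`ψ` of conductor `𝒪`, `½ ∈ 𝒪`, `μ` self-dual).
[cite: MoeglinVignerasWaldspurger1987, Chap. 2 II.8, II.10; Rangarao1993, §2.2 (2.6)–(2.7), Lemma 3.2] -/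
theorem schrodingerLeraySection_integersIndicator_of_parabolic_of_mapsTo (hψ : ψ.IsContinuousNontrivial)
    (hm0 : ψ.HasConductorExp 0) (hμ : IsSelfDualMeasure ψ μ) (h2 : (⅟(2 : F) : F) ∈ primePowBall F 0)
    (q : (symplecticGroup (polar (dotProductBilin F F (m := ι)))))
    (hqY : Submodule.map ((q : ((ι → F) × (ι → F)) ≃ₗ[F] ((ι → F) × (ι → F))) : ((ι → F) × (ι → F)) →ₗ[F] ((ι → F) × (ι → F))) (Submodule.prod (⊥ : Submodule F (ι → F)) (⊤ : Submodule F (ι → F))) = Submodule.prod (⊥ : Submodule F (ι → F)) (⊤ : Submodule F (ι → F)))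
    (hqi : ∀ v ∈ (piPrimePowBall F ι 0) ×ˢ (piPrimePowBall F ι 0),
      (q : ((ι → F) × (ι → F)) ≃ₗ[F] ((ι → F) × (ι → F))) v ∈ (piPrimePowBall F ι 0) ×ˢ (piPrimePowBall F ι 0))
    (hqi' : ∀ v ∈ (piPrimePowBall F ι 0) ×ˢ (piPrimePowBall F ι 0),
      (q : ((ι → F) × (ι → F)) ≃ₗ[F] ((ι → F) × (ι → F))).symm v ∈ (piPrimePowBall F ι 0) ×ˢ (piPrimePowBall F ι 0)) :
    schrodingerLeraySection hl μ hψ hm0 hμ q Φ₀ = Φ₀ := by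
  obtain ⟨a, c, hc, ha, hca, hq⟩ := exists_eq_leviSp_mul_unipotentSp q hqY
  have hAq : ∀ v : (ι → F) × (ι → F), ((q : ((ι → F) × (ι → F)) ≃ₗ[F] ((ι → F) × (ι → F))) v).1 = a v.1 := fun v => by
    rw [hq, Subgroup.coe_mul, LinearEquiv.mul_apply, coe_unipotentSp, unipotentσ_apply, coe_leviSp_apply]
  have hzero : ∀ u ∈ piPrimePowBall F ι 0, ((u, 0) : (ι → F) × (ι → F)) ∈ (piPrimePowBall F ι 0) ×ˢ (piPrimePowBall F ι 0) :=
    fun u hu => Set.mk_mem_prod hu (zero_mem_piPrimePowBall 0)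
  -- `a = A(q)` is integral
  have hai : ∀ u ∈ piPrimePowBall F ι 0, (a : (ι → F) →ₗ[F] (ι → F)) u ∈ piPrimePowBall F ι 0 := fun u hu => by
    have h := (Set.mem_prod.1 (hqi _ (hzero u hu))).1
    rw [hAq] at h
    exact h
  -- `a⁻¹ = A(q⁻¹)` is integral
  have ha'i : ∀ u ∈ piPrimePowBall F ι 0, (a.symm : (ι → F) →ₗ[F] (ι → F)) u ∈ piPrimePowBall F ι 0 := fun u hu => by
    have h := hAq ((q : ((ι → F) × (ι → F)) ≃ₗ[F] ((ι → F) × (ι → F))).symm (u, 0))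
    rw [LinearEquiv.apply_symm_apply] at h
    have h' : a.symm u = (((q : ((ι → F) × (ι → F)) ≃ₗ[F] ((ι → F) × (ι → F))).symm (u, 0))).1 := by
      rw [LinearEquiv.symm_apply_eq]; exact h
    rw [LinearEquiv.coe_coe, h']
    exact (Set.mem_prod.1 (hqi' _ (hzero u hu))).1
  -- `c = ᵗa C(q)` is integral
  have hci : ∀ u ∈ piPrimePowBall F ι 0, c u ∈ piPrimePowBall F ι 0 := fun u hu => by
    rw [hca, transposePi_apply]
    refine mulVec_mem_piPrimePowBall_zero (fun i j => ?_) ?_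
    · rw [Matrix.transpose_apply]
      exact toMatrix'_mem_integers_of_mapsTo _ hai j i
    · rw [blockC_apply]
      exact (Set.mem_prod.1 (hqi _ (hzero u hu))).2
  rw [hq]
  exact schrodingerLeraySection_leviSp_mul_unipotentSp_integersIndicator hl μ Φ₀ hΦ₀ hψ hm0 hμ h2 a
    (toMatrix'_mem_integers_of_mapsTo _ hai) (toMatrix'_mem_integers_of_mapsTo _ ha'i) c hc
    (toMatrix'_mem_integers_of_mapsTo _ hci)

end PiY

/-! ## §3 Any Gram duality `β_T`, any Lagrangian `ℓ = δ ℓ_Y` with `δ` integral -/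

section Gram

variable {F : Type*} [Field F] [ValuativeRel F] [TopologicalSpace F] [IsNonarchimedeanLocalField F] [CharZero F]
  {ι : Type*} [Fintype ι] [DecidableEq ι] [Invertible (2 : F)] (T : Matrix ι ι F) (hT : IsUnit T.det)
  {ψ : AddChar F Circle} (hl : IsLocallyConstant (⇑ψ : F → Circle))
  (hbT : ∀ y : ι → F, Continuous fun u : ι → F => Matrix.toLinearMap₂' F T u y)
  [MeasurableSpace F] [BorelSpace F] (μ : Measure F) [μ.IsAddHaarMeasure]
  (Φ₀ : SchwartzBruhat (ι → F)) (hΦ₀ : (Φ₀ : (ι → F) → ℂ) = (piPrimePowBall F ι 0).indicator fun _ => (1 : ℂ))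

set_option maxHeartbeats 800000 in
include hΦ₀ in
/-- the matrix form below with the two transported elements generalised (proof engine; the many coercions
`Sp(W, A_T) → (W ≃ₗ W)`, `ImplementerSection → (𝒮 ≃ₗ 𝒮)` make its elaboration about twice the default budget).
[cite: MoeglinVignerasWaldspurger1987, Chap. 2 II.8–II.10; Rangarao1993, Thm 3.5, Lemma 5.1] -/
private theorem apply_integersIndicator_eq_self_aux (hψ : ψ.IsContinuousNontrivial)
    (hm0 : ψ.HasConductorExp 0) (h2 : (⅟(2 : F) : F) ∈ primePowBall F 0)
    (hTi : ∀ i j, T i j ∈ primePowBall F 0) (hTi' : ∀ i j, T⁻¹ i j ∈ primePowBall F 0)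
    (hU : ImplementerUniqueUpToScalar (schrodingerSB (Matrix.toLinearMap₂' F T) ψ hl hbT))
    (r : ImplementerSection (schrodingerSB (Matrix.toLinearMap₂' F T) ψ hl hbT))
    {R : Type*} [CommRing R] [IsLocalRing R] (f : R →+* F) (hf : ∀ x : R, f x ∈ primePowBall F 0)
    (A B : Matrix.symplecticGroup ι R) (δ g : symplecticGroup (polar (Matrix.toLinearMap₂' F T)))
    (hδA : transportSp T hT (mapHom f A) = δ) (hgB : transportSp T hT (mapHom f B) = g)
    {ℓ : Submodule F ((ι → F) × (ι → F))}
    (hℓ : LinearMap.BilinForm.orthogonal (alt (polar (Matrix.toLinearMap₂' F T))) ℓ = ℓ)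
    (hr : r.cocycle hU = lerayCentralCocycle μ (isContinuousNontrivial_mulShift_half hψ) (isAlt_alt_polar_gram T)
      (nondegenerate_alt_polar_gram T hT) hℓ)
    (hδ : Submodule.map ((δ : ((ι → F) × (ι → F)) ≃ₗ[F] ((ι → F) × (ι → F))) : ((ι → F) × (ι → F)) →ₗ[F] ((ι → F) × (ι → F)))
      (Submodule.prod (⊥ : Submodule F (ι → F)) (⊤ : Submodule F (ι → F))) = ℓ)
    (hg : Submodule.map ((g : ((ι → F) × (ι → F)) ≃ₗ[F] ((ι → F) × (ι → F))) : ((ι → F) × (ι → F)) →ₗ[F] ((ι → F) × (ι → F))) ℓ = ℓ) :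
    r g Φ₀ = Φ₀ := by
  subst hδ
  have hψ' := isContinuousNontrivial_mulShift_half (F := F) hψ
  have hAT := isAlt_alt_polar_gram (F := F) T
  have hNT := nondegenerate_alt_polar_gram T hT
  have hA1 := isAlt_alt_polar_dotProductBilin (F := F) (ι := ι)
  have hN1 := nondegenerate_alt_polar_dotProductBilin (F := F) (ι := ι)
  have hpol := polar_dotProductBilin_gramProd T hT
  have hA : ∀ v w : ((ι → F) × (ι → F)), (alt (polar (dotProductBilin F F (m := ι)))) ((gramProd T hT) v) ((gramProd T hT) w) =
      (alt (polar (Matrix.toLinearMap₂' F T))) v w := alt_polar_dotProductBilin_gramProd T hT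
  have hA' : ∀ v w : ((ι → F) × (ι → F)), (alt (polar (Matrix.toLinearMap₂' F T))) ((gramProd T hT).symm v) ((gramProd T hT).symm w) =
      (alt (polar (dotProductBilin F F (m := ι)))) v w := fun v w => by
    rw [← hA, LinearEquiv.apply_symm_apply, LinearEquiv.apply_symm_apply]
  have hb : ∀ y : ι → F, Continuous fun u : ι → F => dotProductBilin F F u y := continuous_dotProductBilin_left
  have hρ := schrodingerSB_gram_eq T hT hl hb hbT (ψ := ψ)
  have hU1 := implementerUniqueUpToScalar_schrodingerSB_pi hl hb hψ
  -- `e_T` and `e_T⁻¹` stabilise `ℓ_Y`, which is a Lagrangian of `A_T`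
  have hYe : Submodule.map ((gramProd T hT) : ((ι → F) × (ι → F)) →ₗ[F] ((ι → F) × (ι → F))) (Submodule.prod (⊥ : Submodule F (ι → F)) (⊤ : Submodule F (ι → F))) = (Submodule.prod (⊥ : Submodule F (ι → F)) (⊤ : Submodule F (ι → F))) :=
    map_prod_bot_top_eq_of _ fun v => by rw [gramProd_apply]
  have hYe' : Submodule.map ((gramProd T hT).symm : ((ι → F) × (ι → F)) →ₗ[F] ((ι → F) × (ι → F))) (Submodule.prod (⊥ : Submodule F (ι → F)) (⊤ : Submodule F (ι → F))) = (Submodule.prod (⊥ : Submodule F (ι → F)) (⊤ : Submodule F (ι → F))) :=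
    map_prod_bot_top_eq_of _ fun v => by rw [gramProd_symm_apply T hT]
  have hYT : LinearMap.BilinForm.orthogonal (alt (polar (Matrix.toLinearMap₂' F T))) (Submodule.prod (⊥ : Submodule F (ι → F)) (⊤ : Submodule F (ι → F))) = (Submodule.prod (⊥ : Submodule F (ι → F)) (⊤ : Submodule F (ι → F))) := by
    have h := orthogonal_map_equiv_eq_self (gramProd T hT).symm hA' (orthogonal_prod_bot_top (F := F) (ι := ι))
    rwa [hYe'] at h
  -- the Schrödinger–Leray section `r₀` (self-dual measure) and its transport `rT` to `ρ_T`
  obtain ⟨μ₀, hμ₀, hsd⟩ := exists_isSelfDualMeasure hψ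
  haveI := hμ₀
  have h₀ : (schrodingerLerayImplementerSection hl hb μ₀ hψ hm0 hsd).cocycle hU1 =
      lerayCentralCocycle μ₀ hψ' hA1 hN1 orthogonal_prod_bot_top :=
    schrodingerCocyclePi_eq_lerayCentralCocycle hl hb μ₀ hψ hm0 hsd
  obtain ⟨rT, hrT_def⟩ : ∃ rT : ImplementerSection (schrodingerSB (Matrix.toLinearMap₂' F T) ψ hl hbT),
      rT = ImplementerSection.transport (gramProd T hT) hpol hρ (schrodingerLerayImplementerSection hl hb μ₀ hψ hm0 hsd) :=
    ⟨_, rfl⟩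
  have hrT : rT.cocycle hU = lerayCentralCocycle μ₀ hψ' hAT hNT hYT := by
    refine CentralCocycle.ext fun g₁ g₂ => Units.ext ?_
    rw [hrT_def, ImplementerSection.cocycle_transport (gramProd T hT) hpol hρ _ hU hU1, h₀]
    change lerayCocycle (ψ.mulShift (⅟(2 : F))) μ₀ (alt (polar (dotProductBilin F F (m := ι)))) (Submodule.prod (⊥ : Submodule F (ι → F)) (⊤ : Submodule F (ι → F)))
        ((symplecticConj (gramProd T hT) hpol g₁ : (symplecticGroup (polar (dotProductBilin F F (m := ι))))) : ((ι → F) × (ι → F)) ≃ₗ[F] ((ι → F) × (ι → F)))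
        ((symplecticConj (gramProd T hT) hpol g₂ : (symplecticGroup (polar (dotProductBilin F F (m := ι))))) : ((ι → F) × (ι → F)) ≃ₗ[F] ((ι → F) × (ι → F))) =
      lerayCocycle (ψ.mulShift (⅟(2 : F))) μ₀ (alt (polar (Matrix.toLinearMap₂' F T))) (Submodule.prod (⊥ : Submodule F (ι → F)) (⊤ : Submodule F (ι → F)))
        (g₁ : ((ι → F) × (ι → F)) ≃ₗ[F] ((ι → F) × (ι → F))) (g₂ : ((ι → F) × (ι → F)) ≃ₗ[F] ((ι → F) × (ι → F)))
    rw [coe_symplecticConj, coe_symplecticConj]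
    have h := lerayCocycle_conj μ₀ (gramProd T hT) hA hψ' (Submodule.prod (⊥ : Submodule F (ι → F)) (⊤ : Submodule F (ι → F))) (g₁ : ((ι → F) × (ι → F)) ≃ₗ[F] ((ι → F) × (ι → F))) (g₂ : ((ι → F) × (ι → F)) ≃ₗ[F] ((ι → F) × (ι → F)))
    rwa [hYe] at h
  -- the eigenvalue of `rT(δ)` on `1_{𝒪^ι}`
  obtain ⟨c₀, hc₀⟩ := ImplementerSection.exists_apply_integersIndicator_eq_smul T hT hl hbT f hf Φ₀ hΦ₀ hb μ₀ hψ hm0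
    h2 hU rT A
  rw [hδA] at hc₀
  -- the cocycle of `r` for the measure `μ₀`
  have hr' : r.cocycle hU = lerayCentralCocycle μ₀ hψ' hAT hNT (orthogonal_map_symplectic_eq_self hNT hYT δ) := by
    rw [hr]
    refine CentralCocycle.ext fun g₁ g₂ => Units.ext ?_
    rw [lerayCentralCocycle_apply, lerayCentralCocycle_apply]
    exact lerayCocycle_eq_of_isAddHaarMeasure μ₀ μ hψ' _ _ _ _
  -- rigidity: `r(δ q δ⁻¹) = rT(δ) rT(q) rT(δ)⁻¹` for `q = δ⁻¹ g δ`
  obtain ⟨q, hq_def⟩ : ∃ q : (symplecticGroup (polar (Matrix.toLinearMap₂' F T))), q = δ⁻¹ * g * δ := ⟨_, rfl⟩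
  have hgq : g = δ * q * δ⁻¹ := by rw [hq_def]; group
  have hconj := leraySection_apply_conj μ₀ (monoidHom_symplecticGroup_gram_eq_one T hT) hψ' hAT hNT hYT δ hU rT r
    hrT hr' q
  have hinv : (rT δ).symm Φ₀ = ((c₀⁻¹ : ℂˣ) : ℂ) • Φ₀ := by
    rw [LinearEquiv.symm_apply_eq, map_smul, hc₀, smul_smul, Units.inv_mul, one_smul]
  -- `q ∈ P_{ℓ_Y}`; the transported elements and their inverses preserve `Λ`
  have hqY : Submodule.map ((q : ((ι → F) × (ι → F)) ≃ₗ[F] ((ι → F) × (ι → F))) : ((ι → F) × (ι → F)) →ₗ[F] ((ι → F) × (ι → F))) (Submodule.prod (⊥ : Submodule F (ι → F)) (⊤ : Submodule F (ι → F))) = (Submodule.prod (⊥ : Submodule F (ι → F)) (⊤ : Submodule F (ι → F))) := by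
    have e1 : ((q : ((ι → F) × (ι → F)) ≃ₗ[F] ((ι → F) × (ι → F))) : ((ι → F) × (ι → F)) →ₗ[F] ((ι → F) × (ι → F))) =
        ((δ : ((ι → F) × (ι → F)) ≃ₗ[F] ((ι → F) × (ι → F))).symm : ((ι → F) × (ι → F)) →ₗ[F] ((ι → F) × (ι → F))) ∘ₗ ((g : ((ι → F) × (ι → F)) ≃ₗ[F] ((ι → F) × (ι → F))) : ((ι → F) × (ι → F)) →ₗ[F] ((ι → F) × (ι → F))) ∘ₗ
          ((δ : ((ι → F) × (ι → F)) ≃ₗ[F] ((ι → F) × (ι → F))) : ((ι → F) × (ι → F)) →ₗ[F] ((ι → F) × (ι → F))) :=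
      LinearMap.ext fun v => by
        simp only [hq_def, Subgroup.coe_mul, Subgroup.coe_inv, LinearEquiv.mul_apply, LinearEquiv.coe_inv,
          LinearMap.coe_comp, Function.comp_apply, LinearEquiv.coe_coe]
    have e2 : ((δ : ((ι → F) × (ι → F)) ≃ₗ[F] ((ι → F) × (ι → F))).symm : ((ι → F) × (ι → F)) →ₗ[F] ((ι → F) × (ι → F))) ∘ₗ ((δ : ((ι → F) × (ι → F)) ≃ₗ[F] ((ι → F) × (ι → F))) : ((ι → F) × (ι → F)) →ₗ[F] ((ι → F) × (ι → F))) = LinearMap.id :=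
      LinearMap.ext fun v => (δ : ((ι → F) × (ι → F)) ≃ₗ[F] ((ι → F) × (ι → F))).symm_apply_apply v
    rw [e1, Submodule.map_comp, Submodule.map_comp, hg, ← Submodule.map_comp, e2, Submodule.map_id]
  have hmem : ∀ C : Matrix.symplecticGroup ι R, ∀ v ∈ (piPrimePowBall F ι 0) ×ˢ (piPrimePowBall F ι 0),
      ((transportSp T hT (mapHom f C) : (symplecticGroup (polar (Matrix.toLinearMap₂' F T)))) : ((ι → F) × (ι → F)) ≃ₗ[F] ((ι → F) × (ι → F))) v ∈ (piPrimePowBall F ι 0) ×ˢ (piPrimePowBall F ι 0) :=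
    fun C v hv => transportSp_mapHom_apply_mem T hT hTi hTi' f hf C hv
  have hmem' : ∀ C : Matrix.symplecticGroup ι R, ∀ v ∈ (piPrimePowBall F ι 0) ×ˢ (piPrimePowBall F ι 0),
      ((transportSp T hT (mapHom f C) : (symplecticGroup (polar (Matrix.toLinearMap₂' F T)))) : ((ι → F) × (ι → F)) ≃ₗ[F] ((ι → F) × (ι → F))).symm v ∈ (piPrimePowBall F ι 0) ×ˢ (piPrimePowBall F ι 0) := fun C v hv => by
    have h : ((transportSp T hT (mapHom f C) : (symplecticGroup (polar (Matrix.toLinearMap₂' F T)))) : ((ι → F) × (ι → F)) ≃ₗ[F] ((ι → F) × (ι → F))).symm v =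
        ((transportSp T hT (mapHom f C⁻¹) : (symplecticGroup (polar (Matrix.toLinearMap₂' F T)))) : ((ι → F) × (ι → F)) ≃ₗ[F] ((ι → F) × (ι → F))) v := by
      rw [_root_.map_inv, _root_.map_inv, Subgroup.coe_inv, LinearEquiv.coe_inv]
    rw [h]
    exact hmem C⁻¹ v hv
  have hqC : q = transportSp T hT (mapHom f (A⁻¹ * B * A)) := by
    rw [hq_def, ← hδA, ← hgB, _root_.map_mul, _root_.map_mul, _root_.map_mul, _root_.map_mul, _root_.map_inv,
      _root_.map_inv]
  -- `q₁ = e_T q e_T⁻¹ ∈ P_{ℓ_Y}(𝒪)` for the standard form (generic lemmas of §1b: no unfolding of `e_T`)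
  have he : ∀ v ∈ (piPrimePowBall F ι 0) ×ˢ (piPrimePowBall F ι 0), (gramProd T hT) v ∈ (piPrimePowBall F ι 0) ×ˢ (piPrimePowBall F ι 0) := fun v hv => gramProd_apply_mem T hT hTi hv
  have he' : ∀ v ∈ (piPrimePowBall F ι 0) ×ˢ (piPrimePowBall F ι 0), (gramProd T hT).symm v ∈ (piPrimePowBall F ι 0) ×ˢ (piPrimePowBall F ι 0) := fun v hv => gramProd_symm_apply_mem T hT hTi' hv
  have hqi : ∀ v ∈ (piPrimePowBall F ι 0) ×ˢ (piPrimePowBall F ι 0), (q : ((ι → F) × (ι → F)) ≃ₗ[F] ((ι → F) × (ι → F))) v ∈ (piPrimePowBall F ι 0) ×ˢ (piPrimePowBall F ι 0) := by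
    rw [hqC]; exact hmem _
  have hqi' : ∀ v ∈ (piPrimePowBall F ι 0) ×ˢ (piPrimePowBall F ι 0), (q : ((ι → F) × (ι → F)) ≃ₗ[F] ((ι → F) × (ι → F))).symm v ∈ (piPrimePowBall F ι 0) ×ˢ (piPrimePowBall F ι 0) := by
    rw [hqC]; exact hmem' _
  obtain ⟨q₁, hq₁_def⟩ : ∃ q₁ : (symplecticGroup (polar (dotProductBilin F F (m := ι)))), q₁ = symplecticConj (gramProd T hT) hpol q := ⟨_, rfl⟩
  have hq₁Y : Submodule.map ((q₁ : ((ι → F) × (ι → F)) ≃ₗ[F] ((ι → F) × (ι → F))) : ((ι → F) × (ι → F)) →ₗ[F] ((ι → F) × (ι → F))) (Submodule.prod (⊥ : Submodule F (ι → F)) (⊤ : Submodule F (ι → F))) = (Submodule.prod (⊥ : Submodule F (ι → F)) (⊤ : Submodule F (ι → F))) := by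
    rw [hq₁_def]; exact map_symplecticConj_eq (gramProd T hT) hpol q hYe' hqY hYe
  have hq₁i : ∀ v ∈ (piPrimePowBall F ι 0) ×ˢ (piPrimePowBall F ι 0), (q₁ : ((ι → F) × (ι → F)) ≃ₗ[F] ((ι → F) × (ι → F))) v ∈ (piPrimePowBall F ι 0) ×ˢ (piPrimePowBall F ι 0) := by
    rw [hq₁_def]; exact fun v hv => symplecticConj_apply_mem (gramProd T hT) hpol q he he' hqi hv
  have hq₁i' : ∀ v ∈ (piPrimePowBall F ι 0) ×ˢ (piPrimePowBall F ι 0), (q₁ : ((ι → F) × (ι → F)) ≃ₗ[F] ((ι → F) × (ι → F))).symm v ∈ (piPrimePowBall F ι 0) ×ˢ (piPrimePowBall F ι 0) := by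
    rw [hq₁_def]; exact fun v hv => symplecticConj_symm_apply_mem (gramProd T hT) hpol q he he' hqi' hv
  -- §2: `rT(q) 1_𝒪 = r₀(e_T q e_T⁻¹) 1_𝒪 = 1_𝒪`
  have hfix : rT q Φ₀ = Φ₀ := by
    have h := schrodingerLeraySection_integersIndicator_of_parabolic_of_mapsTo hl μ₀ Φ₀ hΦ₀ hψ hm0 hsd h2 q₁ hq₁Y
      hq₁i hq₁i'
    rw [hq₁_def] at h
    rw [hrT_def]
    exact h
  -- assemble
  rw [hgq, hconj, LinearEquiv.mul_apply, LinearEquiv.mul_apply, LinearEquiv.coe_inv, hinv, map_smul, hfix, map_smul,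
    hc₀, smul_smul, Units.inv_mul, one_smul]

include hΦ₀ in
/-- **THE UNRAMIFIED PARABOLIC CLAUSE (matrix form)**: `F ⊇ ℚ` non-archimedean local, `ψ` of conductor `𝒪`, `½ ∈ 𝒪`,
`T, T⁻¹ ∈ M_ι(𝒪)`; `r` a normalised section of implementers of `ρ_T = schrodingerSB β_T ψ` with cocycle the Leray
cocycle `c^{ψ(½·)}_ℓ` of the Lagrangian `ℓ = δ ℓ_Y`, `δ = transportSp T (A)`, `A ∈ Sp_{2ι}(R)`, `f(R) ⊆ 𝒪` (`R` local).
Then `r(g) 1_{𝒪^ι} = 1_{𝒪^ι}` for every `g = transportSp T (B)`, `B ∈ Sp_{2ι}(R)`, with `g ℓ = ℓ`.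
Rigidity `r(δ q δ⁻¹) = r_Y(δ) r_Y(q) r_Y(δ)⁻¹` (`leraySection_apply_conj`), `r_Y(δ) 1_𝒪 = c 1_𝒪`
(`ImplementerSection.exists_apply_integersIndicator_eq_smul`) and §2 for `e_T q e_T⁻¹ ∈ P_{ℓ_Y}(𝒪)`.
[cite: MoeglinVignerasWaldspurger1987, Chap. 2 II.8–II.10, Chap. 3 §I.3; Rangarao1993, Thm 3.5, Thm 4.1 (5), Lemma 5.1; GelbartRogawski1991, §3.1 (3.1.3), p. 456] -/
theorem apply_integersIndicator_eq_self_of_parabolic_transportSp (hψ : ψ.IsContinuousNontrivial)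
    (hm0 : ψ.HasConductorExp 0) (h2 : (⅟(2 : F) : F) ∈ primePowBall F 0)
    (hTi : ∀ i j, T i j ∈ primePowBall F 0) (hTi' : ∀ i j, T⁻¹ i j ∈ primePowBall F 0)
    (hU : ImplementerUniqueUpToScalar (schrodingerSB (Matrix.toLinearMap₂' F T) ψ hl hbT))
    (r : ImplementerSection (schrodingerSB (Matrix.toLinearMap₂' F T) ψ hl hbT))
    {ℓ : Submodule F ((ι → F) × (ι → F))}
    (hℓ : LinearMap.BilinForm.orthogonal (alt (polar (Matrix.toLinearMap₂' F T))) ℓ = ℓ)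
    (hr : r.cocycle hU = lerayCentralCocycle μ (isContinuousNontrivial_mulShift_half hψ) (isAlt_alt_polar_gram T)
      (nondegenerate_alt_polar_gram T hT) hℓ)
    {R : Type*} [CommRing R] [IsLocalRing R] (f : R →+* F) (hf : ∀ x : R, f x ∈ primePowBall F 0)
    (A : Matrix.symplecticGroup ι R)
    (hδ : Submodule.map (((transportSp T hT (mapHom f A) : symplecticGroup (polar (Matrix.toLinearMap₂' F T))) :
        ((ι → F) × (ι → F)) ≃ₗ[F] ((ι → F) × (ι → F))) : ((ι → F) × (ι → F)) →ₗ[F] ((ι → F) × (ι → F)))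
      (Submodule.prod (⊥ : Submodule F (ι → F)) (⊤ : Submodule F (ι → F))) = ℓ)
    (B : Matrix.symplecticGroup ι R)
    (hg : Submodule.map (((transportSp T hT (mapHom f B) : symplecticGroup (polar (Matrix.toLinearMap₂' F T))) :
        ((ι → F) × (ι → F)) ≃ₗ[F] ((ι → F) × (ι → F))) : ((ι → F) × (ι → F)) →ₗ[F] ((ι → F) × (ι → F))) ℓ = ℓ) :
    r (transportSp T hT (mapHom f B)) Φ₀ = Φ₀ := by
  exact apply_integersIndicator_eq_self_aux T hT hl hbT μ Φ₀ hΦ₀ hψ hm0 h2 hTi hTi' hU r f hf A B _ _ rfl rfl hℓ hr hδ hg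

include hT μ hΦ₀ in
omit [CharZero F] in
/-- **`r(g) 1_{𝒪^ι} ∈ ℂˣ 1_{𝒪^ι}` for every `g ∈ Sp(W, A_T)` preserving `Λ = 𝒪^ι × 𝒪^ι`** (`T, T⁻¹ ∈ M_ι(𝒪)`, `ψ` of
conductor `𝒪`, `½ ∈ 𝒪`), for every normalised implementer section `r` of `ρ_T` — `SchrodingerUnramifiedVector` made
coordinate-free by `exists_eq_transportSp_mapHom_of_mapsTo`.
[cite: MoeglinVignerasWaldspurger1987, Chap. 2 II.10; GelbartRogawski1991, §3.1 (3.1.3), p. 456] -/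
theorem ImplementerSection.exists_apply_integersIndicator_eq_smul_of_mapsTo (hψ : ψ.IsContinuousNontrivial)
    (hm0 : ψ.HasConductorExp 0) (h2 : (⅟(2 : F) : F) ∈ primePowBall F 0)
    (hTi : ∀ i j, T i j ∈ primePowBall F 0) (hTi' : ∀ i j, T⁻¹ i j ∈ primePowBall F 0)
    (hU : ImplementerUniqueUpToScalar (schrodingerSB (Matrix.toLinearMap₂' F T) ψ hl hbT))
    (r : ImplementerSection (schrodingerSB (Matrix.toLinearMap₂' F T) ψ hl hbT))
    (g : symplecticGroup (polar (Matrix.toLinearMap₂' F T)))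
    (hgi : ∀ v ∈ (piPrimePowBall F ι 0) ×ˢ (piPrimePowBall F ι 0),
      (g : ((ι → F) × (ι → F)) ≃ₗ[F] ((ι → F) × (ι → F))) v ∈ (piPrimePowBall F ι 0) ×ˢ (piPrimePowBall F ι 0)) :
    ∃ c : ℂˣ, r g Φ₀ = (c : ℂ) • Φ₀ := by
  obtain ⟨A, hA⟩ := exists_eq_transportSp_mapHom_of_mapsTo T hT hTi hTi' g hgi
  rw [← hA]
  exact ImplementerSection.exists_apply_integersIndicator_eq_smul T hT hl hbT _ integer_subtype_mem Φ₀ hΦ₀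
    continuous_dotProductBilin_left μ hψ hm0 h2 hU r A

include hΦ₀ in
/-- **THE UNRAMIFIED PARABOLIC CLAUSE (coordinate-free form)**: `F ⊇ ℚ` non-archimedean local, `ψ` of conductor `𝒪`,
`½ ∈ 𝒪`, `T, T⁻¹ ∈ M_ι(𝒪)`, `Λ = 𝒪^ι × 𝒪^ι`; `r` a normalised section of implementers of `ρ_T = schrodingerSB β_T ψ`
whose cocycle is the Leray cocycle `c^{ψ(½·)}_ℓ` of a Lagrangian `ℓ = δ ℓ_Y` with `δ ∈ Sp(W, A_T)`, `δ Λ ⊆ Λ`.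
Then `r(g) 1_{𝒪^ι} = 1_{𝒪^ι}` for every `g ∈ Sp(W, A_T)` with `g ℓ = ℓ` and `g Λ ⊆ Λ`: the representation
`g ↦ r(g)` of the integral points of the stabiliser `P_ℓ` FIXES the unramified vector.
[cite: MoeglinVignerasWaldspurger1987, Chap. 2 II.8–II.10, Chap. 3 §I.3; Rangarao1993, Thm 3.5, Thm 4.1 (5), Lemma 5.1; GelbartRogawski1991, §3.1 (3.1.3), p. 456] -/
theorem apply_integersIndicator_eq_self_of_parabolic_of_mapsTo (hψ : ψ.IsContinuousNontrivial)
    (hm0 : ψ.HasConductorExp 0) (h2 : (⅟(2 : F) : F) ∈ primePowBall F 0)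
    (hTi : ∀ i j, T i j ∈ primePowBall F 0) (hTi' : ∀ i j, T⁻¹ i j ∈ primePowBall F 0)
    (hU : ImplementerUniqueUpToScalar (schrodingerSB (Matrix.toLinearMap₂' F T) ψ hl hbT))
    (r : ImplementerSection (schrodingerSB (Matrix.toLinearMap₂' F T) ψ hl hbT))
    {ℓ : Submodule F ((ι → F) × (ι → F))}
    (hℓ : LinearMap.BilinForm.orthogonal (alt (polar (Matrix.toLinearMap₂' F T))) ℓ = ℓ)
    (hr : r.cocycle hU = lerayCentralCocycle μ (isContinuousNontrivial_mulShift_half hψ) (isAlt_alt_polar_gram T)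
      (nondegenerate_alt_polar_gram T hT) hℓ)
    (δ : symplecticGroup (polar (Matrix.toLinearMap₂' F T)))
    (hδi : ∀ v ∈ (piPrimePowBall F ι 0) ×ˢ (piPrimePowBall F ι 0),
      (δ : ((ι → F) × (ι → F)) ≃ₗ[F] ((ι → F) × (ι → F))) v ∈ (piPrimePowBall F ι 0) ×ˢ (piPrimePowBall F ι 0))
    (hδ : Submodule.map ((δ : ((ι → F) × (ι → F)) ≃ₗ[F] ((ι → F) × (ι → F))) : ((ι → F) × (ι → F)) →ₗ[F] ((ι → F) × (ι → F)))
      (Submodule.prod (⊥ : Submodule F (ι → F)) (⊤ : Submodule F (ι → F))) = ℓ)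
    (g : symplecticGroup (polar (Matrix.toLinearMap₂' F T)))
    (hg : Submodule.map ((g : ((ι → F) × (ι → F)) ≃ₗ[F] ((ι → F) × (ι → F))) : ((ι → F) × (ι → F)) →ₗ[F] ((ι → F) × (ι → F))) ℓ = ℓ)
    (hgi : ∀ v ∈ (piPrimePowBall F ι 0) ×ˢ (piPrimePowBall F ι 0),
      (g : ((ι → F) × (ι → F)) ≃ₗ[F] ((ι → F) × (ι → F))) v ∈ (piPrimePowBall F ι 0) ×ˢ (piPrimePowBall F ι 0)) :
    r g Φ₀ = Φ₀ := by
  obtain ⟨A, hA⟩ := exists_eq_transportSp_mapHom_of_mapsTo T hT hTi hTi' δ hδi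
  obtain ⟨B, hB⟩ := exists_eq_transportSp_mapHom_of_mapsTo T hT hTi hTi' g hgi
  subst hA hB
  exact apply_integersIndicator_eq_self_of_parabolic_transportSp T hT hl hbT μ Φ₀ hΦ₀ hψ hm0 h2 hTi hTi' hU r hℓ hr _
    integer_subtype_mem A hδ B hg

end Gram

end Literature.RepresentationTheory.HeisenbergGroup

end
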